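import Literature.Geometry.Lorentzian.KerrSchildMultiplierCurrent
import Literature.Geometry.Lorentzian.MinkowskiRadialMultiplier

/-!
# Route ClusterCompleteness — crux `AdiabaticMultiKerrILED`: the Milne velocity current

Helper file for the crux `stmt-FinalStateConjecture-14310` (line `Sketch`, lead c6 wave 1, card
milne-hubble-current).

Inside the future light cone of an event `x₀` of Minkowski space (`η = diag(−1, 1, 1, 1)`,
`Minkowski.bilin`) the **Milne time** is `τ(y) = √(−η(y − x₀, y − x₀))` and the **Milne
4-velocity** is `V = (y − x₀)/τ` (unit timelike, geodesic, expansion `3/τ`). With `z = x − x₀`,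
`u = −η(z, z) > 0`, `p_μ = ∂_μ w(x)`, `Q = ∑ η^{αβ} p_α p_β` and `V(w) = ∑ V^α p_α` we prove, in the
coefficient-field framework of `KerrSchild.multiplierBulk` / `KerrSchild.waveOperator`:

* `waveOperator_eta_inv_milneTime` — `□_η (1/τ) = 1/τ³` (`∂_μ(1/τ) = η_{μμ} z_μ/τ³`,
  `∑_μ ∂_μ(z_μ/τ³) = 4/τ³ − 3u/τ⁵`);
* `multiplierBulk_eta_milneVelocity` — the bulk of the Milne velocity multiplier,
  `K^V = τ⁻¹ (V(w)² − ½ Q)` (from `K^{fS} = f K^S + (A·∂f) S(w) − ½ S(f) Q`,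
  `KerrSchild.multiplierBulk_smul`, with `S = y − x₀`, `K^S = −Q`, `f = 1/τ`);
* `modifiedBulk_eta_milneVelocity` — the Lagrangian-corrected ("Hubble dissipation") form with
  weight `ϖ = 4c/τ`: `K^V + ¼ ϖ Q − ⅛ (□_η ϖ) w² = τ⁻¹ (V(w)² + (c − ½) Q) − (c/2) τ⁻³ w²`.

Elementary multiplier calculus on Minkowski space. [folklore]
-/

noncomputable section

-- the doubled `FinalStateConjecture.FinalStateConjecture` path component trips dupNamespace
set_option linter.dupNamespace false

open scoped BigOperators Topology
open Filter Set Literature.Geometry.Lorentzian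

namespace Summit.FinalStateConjecture.FinalStateConjecture.Theorems

/-! ### The Lorentzian interval to `x₀` and the inverse Milne time `1/τ` -/

/-- `−η(y − x₀, y − x₀) = (y⁰ − x₀⁰)² − ∑ᵢ (yⁱ − x₀ⁱ)²`. [folklore] -/
theorem milne_interval_eq (x₀ y : E4) :
    -(Minkowski.bilin (y - x₀) (y - x₀)) =
      (y 0 - x₀ 0) ^ 2 - (y 1 - x₀ 1) ^ 2 - (y 2 - x₀ 2) ^ 2 - (y 3 - x₀ 3) ^ 2 := by
  simp only [Minkowski.bilin_apply, Fin.sum_univ_three, PiLp.sub_apply, Fin.reduceSucc]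
  ring

/-- **`d(−η(y − x₀, y − x₀)) = 2 (y⁰ − x₀⁰) dx⁰ − 2 ∑ᵢ (yⁱ − x₀ⁱ) dxⁱ`.** [folklore] -/
theorem milne_hasFDerivAt_interval (x₀ y : E4) :
    HasFDerivAt (fun z : E4 ↦ -(Minkowski.bilin (z - x₀) (z - x₀)))
      ((2 * (y 0 - x₀ 0)) • E4.dx 0 - (2 * (y 1 - x₀ 1)) • E4.dx 1 - (2 * (y 2 - x₀ 2)) • E4.dx 2 -
        (2 * (y 3 - x₀ 3)) • E4.dx 3) y := by
  have h : (fun z : E4 ↦ -(Minkowski.bilin (z - x₀) (z - x₀))) =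
      fun z ↦ (z 0 - x₀ 0) ^ 2 - (z 1 - x₀ 1) ^ 2 - (z 2 - x₀ 2) ^ 2 - (z 3 - x₀ 3) ^ 2 :=
    funext (milne_interval_eq x₀)
  rw [h]
  have h0 := ((KerrSchild.hasFDerivAt_coord 0 y).sub_const (x₀ 0)).pow 2
  have h1 := ((KerrSchild.hasFDerivAt_coord 1 y).sub_const (x₀ 1)).pow 2
  have h2 := ((KerrSchild.hasFDerivAt_coord 2 y).sub_const (x₀ 2)).pow 2
  have h3 := ((KerrSchild.hasFDerivAt_coord 3 y).sub_const (x₀ 3)).pow 2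
  refine (((h0.sub h1).sub h2).sub h3).congr_fderiv ?_
  ext v
  simp only [sub_apply, smul_apply, smul_eq_mul, nsmul_eq_mul, pow_one, Nat.add_one_sub_one,
    Nat.cast_ofNat]

/-- The interval `y ↦ −η(y − x₀, y − x₀)` is continuous. [folklore] -/
theorem milne_continuous_interval (x₀ : E4) :
    Continuous fun z : E4 ↦ -(Minkowski.bilin (z - x₀) (z - x₀)) :=
  continuous_iff_continuousAt.mpr fun y ↦ (milne_hasFDerivAt_interval x₀ y).continuousAt

/-- `d/dt [1/√t] = −½ (1/√t)³` for `t > 0`. [folklore] -/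
theorem milne_hasDerivAt_inv_sqrt {t : ℝ} (ht : 0 < t) :
    HasDerivAt (fun u ↦ (Real.sqrt u)⁻¹) (-(1 / 2) * (Real.sqrt t)⁻¹ ^ 3) t := by
  have hs : Real.sqrt t ≠ 0 := (Real.sqrt_pos.mpr ht).ne'
  refine ((Real.hasDerivAt_sqrt ht.ne').inv hs).congr_deriv ?_
  field_simp

/-- **`d(1/τ) = τ⁻³ (−(y⁰ − x₀⁰) dx⁰ + ∑ᵢ (yⁱ − x₀ⁱ) dxⁱ) = τ⁻³ η(y − x₀, ·)`** inside the light
cone of `x₀` (`τ = √(−η(y − x₀, y − x₀)) > 0`). [folklore] -/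
theorem milne_hasFDerivAt_invTime (x₀ : E4) {y : E4}
    (hy : 0 < -(Minkowski.bilin (y - x₀) (y - x₀))) :
    HasFDerivAt (fun z : E4 ↦ (Real.sqrt (-(Minkowski.bilin (z - x₀) (z - x₀))))⁻¹)
      (((Real.sqrt (-(Minkowski.bilin (y - x₀) (y - x₀))))⁻¹ ^ 3) •
        ((-(y 0 - x₀ 0)) • E4.dx 0 + (y 1 - x₀ 1) • E4.dx 1 + (y 2 - x₀ 2) • E4.dx 2 +
          (y 3 - x₀ 3) • E4.dx 3)) y := by
  have h := (milne_hasDerivAt_inv_sqrt hy).comp_hasFDerivAt y (milne_hasFDerivAt_interval x₀ y)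
  have h' : HasFDerivAt (fun z : E4 ↦ (Real.sqrt (-(Minkowski.bilin (z - x₀) (z - x₀))))⁻¹) _ y :=
    h
  refine h'.congr_fderiv ?_
  ext v
  simp only [sub_apply, smul_apply, add_apply, smul_eq_mul]
  ring

/-- `τ⁻² · ((x⁰ − x₀⁰)² − ∑ᵢ (xⁱ − x₀ⁱ)²) = 1` inside the light cone of `x₀`. [folklore] -/
theorem milne_invTime_sq_mul (x₀ : E4) {x : E4}
    (hx : 0 < -(Minkowski.bilin (x - x₀) (x - x₀))) :
    (Real.sqrt (-(Minkowski.bilin (x - x₀) (x - x₀))))⁻¹ ^ 2 *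
        ((x 0 - x₀ 0) ^ 2 - (x 1 - x₀ 1) ^ 2 - (x 2 - x₀ 2) ^ 2 - (x 3 - x₀ 3) ^ 2) = 1 := by
  rw [← milne_interval_eq, inv_pow, Real.sq_sqrt hx.le, inv_mul_cancel₀ hx.ne']

/-! ### The wave operator of `a/τ` -/

/-- Inside the light cone, `∑_ν η^{μν} ∂_ν (a/τ) = a τ⁻³ (y^μ − x₀^μ)` near `x`. [folklore] -/
theorem milne_inner_eventuallyEq (x₀ : E4) (a : ℝ) {x : E4}
    (hx : 0 < -(Minkowski.bilin (x - x₀) (x - x₀))) (μ : Fin 4) :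
    (fun y : E4 ↦ ∑ ν, Kerr.etaComp μ ν *
        fderiv ℝ (fun z : E4 ↦ a * (Real.sqrt (-(Minkowski.bilin (z - x₀) (z - x₀))))⁻¹) y
          (E4.basisVector ν)) =ᶠ[𝓝 x]
      fun y ↦ a * (Real.sqrt (-(Minkowski.bilin (y - x₀) (y - x₀))))⁻¹ ^ 3 * (y μ - x₀ μ) := by
  have hnear : ∀ᶠ y in 𝓝 x, 0 < -(Minkowski.bilin (y - x₀) (y - x₀)) :=
    (milne_continuous_interval x₀).continuousAt.eventually (eventually_gt_nhds hx)
  filter_upwards [hnear] with y hy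
  rw [((milne_hasFDerivAt_invTime x₀ hy).const_mul a).fderiv]
  simp only [smul_apply, add_apply, smul_eq_mul, Kerr.dx_basisVector, KerrSchild.etaComp_eq,
    Fin.sum_univ_four, Fin.isValue, Fin.reduceEq, if_true, if_false]
  fin_cases μ <;> simp <;> ring

/-- Inside the light cone, `∂_μ (∑_ν η^{μν} ∂_ν (a/τ)) (x) = a τ⁻³ + 3 a τ⁻⁵ η_{μμ} (x^μ − x₀^μ)²`
(no summation). [folklore] -/
theorem milne_fderiv_inner (x₀ : E4) (a : ℝ) {x : E4}
    (hx : 0 < -(Minkowski.bilin (x - x₀) (x - x₀))) (μ : Fin 4) :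
    fderiv ℝ (fun y : E4 ↦ ∑ ν, Kerr.etaComp μ ν *
        fderiv ℝ (fun z : E4 ↦ a * (Real.sqrt (-(Minkowski.bilin (z - x₀) (z - x₀))))⁻¹) y
          (E4.basisVector ν)) x (E4.basisVector μ) =
      a * (Real.sqrt (-(Minkowski.bilin (x - x₀) (x - x₀))))⁻¹ ^ 3 +
        3 * a * (Real.sqrt (-(Minkowski.bilin (x - x₀) (x - x₀))))⁻¹ ^ 5 *
          ((-(x 0 - x₀ 0)) • E4.dx 0 + (x 1 - x₀ 1) • E4.dx 1 + (x 2 - x₀ 2) • E4.dx 2 +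
            (x 3 - x₀ 3) • E4.dx 3) (E4.basisVector μ) * (x μ - x₀ μ) := by
  rw [(milne_inner_eventuallyEq x₀ a hx μ).fderiv_eq]
  have h := (((milne_hasFDerivAt_invTime x₀ hx).pow 3).const_mul a).fun_mul
    ((KerrSchild.hasFDerivAt_coord μ x).sub_const (x₀ μ))
  rw [h.fderiv]
  simp only [add_apply, smul_apply, smul_eq_mul, Kerr.dx_basisVector, if_true, nsmul_eq_mul,
    Nat.cast_ofNat, Nat.add_one_sub_one]
  ring

/-- **`□_η (a/τ) = a/τ³` inside the light cone of `x₀`** (`τ = √(−η(y − x₀, y − x₀))`):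
`□_η (a/τ) = ∑_μ ∂_μ (a z^μ τ⁻³) = 4a τ⁻³ + 3a τ⁻⁵ ∑_μ η_{μμ} (z^μ)² = 4a τ⁻³ − 3a τ⁻³`,
`z = x − x₀`. [folklore] -/
theorem milne_waveOperator_const_mul_invTime (x₀ : E4) (a : ℝ) {x : E4}
    (hx : 0 < -(Minkowski.bilin (x - x₀) (x - x₀))) :
    KerrSchild.waveOperator (fun _ ↦ Kerr.etaComp)
        (fun y ↦ a * (Real.sqrt (-(Minkowski.bilin (y - x₀) (y - x₀))))⁻¹) x =
      a * (Real.sqrt (-(Minkowski.bilin (x - x₀) (x - x₀))))⁻¹ ^ 3 := by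
  have hpW := milne_invTime_sq_mul x₀ hx
  rw [KerrSchild.waveOperator_apply, Fin.sum_univ_four, milne_fderiv_inner x₀ a hx 0,
    milne_fderiv_inner x₀ a hx 1, milne_fderiv_inner x₀ a hx 2, milne_fderiv_inner x₀ a hx 3]
  simp only [add_apply, smul_apply, smul_eq_mul, Kerr.dx_basisVector, Fin.isValue, Fin.reduceEq,
    if_true, if_false, mul_one, mul_zero, add_zero, zero_add]
  generalize (Real.sqrt (-(Minkowski.bilin (x - x₀) (x - x₀))))⁻¹ = p at hpW ⊢
  linear_combination (-3 * a * p ^ 3) * hpW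

/-- **`□_η (1/τ) = 1/τ³`** for the inverse Milne time `1/τ`, `τ(y) = √(−η(y − x₀, y − x₀))`,
inside the future (or past) light cone of `x₀` (`∂_μ (1/τ) = η_{μμ}(x^μ − x₀^μ)/τ³`,
`□_η = −∂₀² + Δ`). [folklore] -/
theorem waveOperator_eta_inv_milneTime :
    ∀ (x₀ x : E4) (hx : 0 < -(Minkowski.bilin (x - x₀) (x - x₀))),
      KerrSchild.waveOperator (fun _ ↦ Kerr.etaComp)
          (fun y ↦ (Real.sqrt (-(Minkowski.bilin (y - x₀) (y - x₀))))⁻¹) x =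
        ((Real.sqrt (-(Minkowski.bilin (x - x₀) (x - x₀))))⁻¹) ^ 3 := by
  intro x₀ x hx
  have h := milne_waveOperator_const_mul_invTime x₀ 1 hx
  simp only [one_mul] at h
  exact h

/-! ### The bulk of the Milne velocity multiplier -/

/-- **The bulk of the translation-invariant homothety field `S = y − x₀` on Minkowski space is
`K^S = −Q`**, `Q = ∑ η^{αβ} ∂_αw ∂_βw` (`∂_μ S^β = δ_μ^β`, `div S = 4`, `∂η = 0`:
`K^S = Q − ½ · 4 · Q`). [folklore] -/
theorem milne_multiplierBulk_eta_translate (x₀ : E4) (w : E4 → ℝ) (x : E4) :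
    KerrSchild.multiplierBulk (fun _ ↦ Kerr.etaComp) (fun y α ↦ y α - x₀ α) w x =
      -(∑ α, ∑ β, Kerr.etaComp α β * fderiv ℝ w x (E4.basisVector α) *
        fderiv ℝ w x (E4.basisVector β)) := by
  have hd : ∀ β μ : Fin 4, fderiv ℝ (fun y : E4 ↦ y β - x₀ β) x (E4.basisVector μ) =
      if β = μ then 1 else 0 := fun β μ ↦ by
    rw [fderiv_sub_const, KerrSchild.fderiv_coord_apply]
  have hη : ∀ α β : Fin 4, fderiv ℝ (fun _ : E4 ↦ Kerr.etaComp α β) x = 0 := fun α β ↦ by simp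
  simp only [KerrSchild.multiplierBulk, hd, hη, zero_apply, zero_mul, Finset.sum_const_zero,
    mul_zero, sub_zero]
  obtain ⟨p, hp⟩ : ∃ p : Fin 4 → ℝ, ∀ κ, fderiv ℝ w x (E4.basisVector κ) = p κ := ⟨_, fun _ ↦ rfl⟩
  simp only [hp, KerrSchild.etaComp_eq, Fin.sum_univ_four, Fin.isValue, Fin.reduceEq, if_true,
    if_false]
  ring

/-- **The bulk of the Milne velocity multiplier `V = (y − x₀)/τ` on Minkowski space**,
`τ = √(−η(y − x₀, y − x₀))`, inside the light cone of `x₀`: with `p_μ = ∂_μ w(x)`,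
`V(w) = ∑_α V^α p_α` and `Q = ∑ η^{αβ} p_α p_β`,
`K^V = τ⁻¹ (V(w)² − ½ Q)`
(`V = f S` with `f = 1/τ`, `S = y − x₀`: `K^{fS} = f K^S + (∑_μ A^μ ∂_μ f) S(w) − ½ S(f) Q` by
`KerrSchild.multiplierBulk_smul`, `K^S = −Q`, `∑_μ A^μ ∂_μ f = S(w)/τ³`, `S(f) = η(S,S)/τ³ = −1/τ`;
the hyperbolic analogue of Morawetz's radial identity `KerrSchild.multiplierBulk_eta_dr_add`).
[folklore] -/
theorem multiplierBulk_eta_milneVelocity :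
    ∀ (x₀ : E4) (w : E4 → ℝ) (x : E4) (hx : 0 < -(Minkowski.bilin (x - x₀) (x - x₀))),
      KerrSchild.multiplierBulk (fun _ ↦ Kerr.etaComp)
          (fun y α ↦ (y α - x₀ α) / Real.sqrt (-(Minkowski.bilin (y - x₀) (y - x₀)))) w x =
        (Real.sqrt (-(Minkowski.bilin (x - x₀) (x - x₀))))⁻¹ *
          ((∑ α, (x α - x₀ α) / Real.sqrt (-(Minkowski.bilin (x - x₀) (x - x₀))) *
                fderiv ℝ w x (E4.basisVector α)) ^ 2 -
            2⁻¹ * ∑ α, ∑ β, Kerr.etaComp α β * fderiv ℝ w x (E4.basisVector α) *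
              fderiv ℝ w x (E4.basisVector β)) := by
  intro x₀ w x hx
  have hfun : (fun (y : E4) (α : Fin 4) ↦
      (y α - x₀ α) / Real.sqrt (-(Minkowski.bilin (y - x₀) (y - x₀)))) =
      fun y α ↦ (Real.sqrt (-(Minkowski.bilin (y - x₀) (y - x₀))))⁻¹ * (y α - x₀ α) := by
    funext y α
    rw [div_eq_inv_mul]
  have hg := (milne_hasFDerivAt_invTime x₀ hx).differentiableAt
  have hS : ∀ α : Fin 4, DifferentiableAt ℝ (fun y : E4 ↦ y α - x₀ α) x := fun α ↦
    (KerrSchild.hasFDerivAt_coord α x).differentiableAt.sub_const (x₀ α)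
  have hpW := milne_invTime_sq_mul x₀ hx
  rw [hfun, KerrSchild.multiplierBulk_smul (fun _ ↦ Kerr.etaComp) w hg hS,
    milne_multiplierBulk_eta_translate x₀ w x, (milne_hasFDerivAt_invTime x₀ hx).fderiv]
  obtain ⟨P, hP⟩ : ∃ P : Fin 4 → ℝ, ∀ κ, fderiv ℝ w x (E4.basisVector κ) = P κ :=
    ⟨_, fun _ ↦ rfl⟩
  simp only [hP, smul_apply, add_apply, smul_eq_mul, Kerr.dx_basisVector, KerrSchild.etaComp_eq,
    Fin.sum_univ_four, Fin.isValue, Fin.reduceEq, if_true, if_false, div_eq_mul_inv]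
  generalize (Real.sqrt (-(Minkowski.bilin (x - x₀) (x - x₀))))⁻¹ = p at hpW ⊢
  linear_combination (2⁻¹ * p * (-P 0 ^ 2 + P 1 ^ 2 + P 2 ^ 2 + P 3 ^ 2)) * hpW

/-- **The Lagrangian-corrected ("Hubble dissipation") bulk of the Milne velocity multiplier.**
With the weight `ϖ = 4c/τ` (`□_η ϖ = 4c/τ³` by `waveOperator_eta_inv_milneTime`), inside the
light cone of `x₀`:
`K^V + ¼ ϖ Q − ⅛ (□_η ϖ) w² = τ⁻¹ (V(w)² + (c − ½) Q) − (c/2) τ⁻³ w²`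
— the bulk of the modified current `J^V + ¼ L_ϖ` of `KerrSchild.sum_fderiv_modifiedCurrent`;
for `c = ½` it is `τ⁻¹ V(w)² − ¼ τ⁻³ w²`. [folklore] -/
theorem modifiedBulk_eta_milneVelocity :
    ∀ (x₀ : E4) (c : ℝ) (w : E4 → ℝ) (x : E4) (hx : 0 < -(Minkowski.bilin (x - x₀) (x - x₀))),
      KerrSchild.multiplierBulk (fun _ ↦ Kerr.etaComp)
            (fun y α ↦ (y α - x₀ α) / Real.sqrt (-(Minkowski.bilin (y - x₀) (y - x₀)))) w x +
          4⁻¹ * ((4 * c / Real.sqrt (-(Minkowski.bilin (x - x₀) (x - x₀)))) *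
            ∑ α, ∑ β, Kerr.etaComp α β * fderiv ℝ w x (E4.basisVector α) *
              fderiv ℝ w x (E4.basisVector β)) -
          8⁻¹ * KerrSchild.waveOperator (fun _ ↦ Kerr.etaComp)
            (fun y ↦ 4 * c / Real.sqrt (-(Minkowski.bilin (y - x₀) (y - x₀)))) x * w x ^ 2 =
        (Real.sqrt (-(Minkowski.bilin (x - x₀) (x - x₀))))⁻¹ *
            ((∑ α, (x α - x₀ α) / Real.sqrt (-(Minkowski.bilin (x - x₀) (x - x₀))) *
                  fderiv ℝ w x (E4.basisVector α)) ^ 2 +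
              (c - 2⁻¹) * ∑ α, ∑ β, Kerr.etaComp α β * fderiv ℝ w x (E4.basisVector α) *
                fderiv ℝ w x (E4.basisVector β)) -
          c / 2 * (Real.sqrt (-(Minkowski.bilin (x - x₀) (x - x₀))))⁻¹ ^ 3 * w x ^ 2 := by
  intro x₀ c w x hx
  have hfun : (fun y : E4 ↦ 4 * c / Real.sqrt (-(Minkowski.bilin (y - x₀) (y - x₀)))) =
      fun y ↦ 4 * c * (Real.sqrt (-(Minkowski.bilin (y - x₀) (y - x₀))))⁻¹ :=
    funext fun y ↦ div_eq_mul_inv _ _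
  rw [multiplierBulk_eta_milneVelocity x₀ w x hx, hfun,
    milne_waveOperator_const_mul_invTime x₀ (4 * c) hx, div_eq_mul_inv]
  ring

end Summit.FinalStateConjecture.FinalStateConjecture.Theorems
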